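import Summits.Ventures.HSemireg.GeneralStructureWiringAnchor
import Summits.HodgeConjecture.HodgeConjecture.Theorems.PadicSemiregularLiftHodgeAbelianVarietiesStubCmAnchoredFamilies
import Literature.AlgebraicGeometry.Motives.AlgPointsNonempty
import HarnessLib

/-!
# HSemireg venture · general structure (G4) — the WIRING, FAMILY-LEVEL forms: the red team's dichotomy (F1)/(F2) in the kernel,
# and the deformation-free shadow (★) every form entails

HONEST FRAMING (speculative tier of cell `pub-hsemireg`, team «general structure», seat G4; verbatim the cell's wording rule):
**nothing here says `HC_AV` or `HC_CM` is proved; every implication carries its named hypotheses.** No `sorry`, no new axiom;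
axioms `propext`, `Classical.choice`, `Quot.sound`. `HC_CM` = `Theses.RankFourFaces.CMAbelianHodge` (stmt-3052, binder); `HC_AV` =
`Theses.PadicSemiregularLift.HodgeAbelianVarieties` (stmt-1333).

Red-team finding RED-GS GS-8 (2026-08-22T05:25Z) on the landed per-component ∃-form `ExistsSemiregularSheafCMAnchor C`
(`GeneralStructureWiringAnchor.lean`): the ∃ over CM fibres sits inside a ∀ over ALL admissible bases, and base change is free, so
(a) restricted to a generic curve through one CM point it is forced to that point, and (b) restricted to the point base `Spec ℂ` it
entails the DEFORMATION-FREE statement (★) of GS-9 — «every (rational) algebraic class on every CM abelian variety is a `ℂ`-combination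
of `ch_p` of `I`-semiregular finite locally free sheaves» — which is TRUE FOR FREE at the divisor-generated product points `E^{2n}` where
the team's tables live (ample line bundles, hard Lefschetz) and has content only for EXCEPTIONAL classes. GS-8 offers exactly two honest
re-typings; this file lands BOTH, by name, with their honest columns, and the shadow (★) as a theorem:

* (F2) `SemiregularPresentedFamilies C` — ∃ OVER FAMILIES («one witness family per Hodge class»; the Mumford–Tate family of `(A, c)`
  with ONE point carrying a semiregular presentation serves every class with that family): with Buchweitz–Flenner Thm. 5.1 ALONE it
  gives `HC_AV` (`hc_av_of_buchweitzFlenner_of_semiregularPresentedFamilies`) — `HC_CM` and «CM» are IDLE here, and the implication is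
  Bloch 1972, Introduction p. 51 («it reduces Grothendieck's conjecture to the problem of finding semi-regular representatives») +
  Cattani–Deligne–Kaplan / Charles–Schnell Prop. 11.3.11: grade KNOWN REDUCTION. This is the form a coverage table (one point + one
  representative per component) literally witnesses, component by component.
* (F1) `ExistsSemiregularSheafCMAnchorDense C` — ∀ over CM-DENSE families (Deligne's Mumford–Tate families, `Ring2.Deform.cmLocus` dense
  in `S(ℂ)`, Milne's typing `IsOfCMType`), `G` algebraic at every CM fibre ⟹ SOME CM fibre carries a presentation: `HC_CM` LOAD-BEARING
  (`HC_CM ∧ [Deligne 1982, dense form] ∧ (F1) ⟹ (F2)`, `semiregularPresentedFamilies_of_hc_cm_of_cmDense_of_existsAnchorDense`), hence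
  `HC_AV` with BF 5.1. Density kills the curve base change (a); it does NOT kill the point base change (b) for CM `A` (a point is CM-dense):
  (F1) still entails (★) — recorded as `existsAnchorDense_pointBase`. And (F1) still quantifies over every CM-dense (special) sub-family.
  GS-8: «there is NO typing that is simultaneously ∀-over-families, HC_CM-load-bearing, and one-witness-per-component» — the kernel agrees:
  (F1) is the weakest `HC_CM`-load-bearing form (`existsAnchorDense_of_existsAnchor`: landed ∃-form ⟹ (F1)), (F2) the witness form.
* (★) in kernel form: `existsAnchor_pointBase` — the landed ∃-form gives, for every CM `A₀` (eigenvalue typing) and every RATIONAL algebraic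
  `(p,p)` class `c` on `A₀`, a semiregular presentation of `c` on the fibre of the constant family `A₀ ⟶ Spec ℂ` (the base has one point;
  horizontality is vacuous). The ∀-form and the thinned forms inherit it through `Ladder.existsAnchor_of_uniformSheafLift`.

HIDDEN PARAMETER (red-1 V2-L4, listed here and in the ledger): every SHEAF-form end statement is `∀ C : ChernCharacterBetti, …`; the tree
vendors NO instance of `ChernCharacterBetti` (construction stub `Nonempty ChernCharacterBetti` elsewhere) — a fifth, construction-type
input of the sheaf rows; the cycle form (`GeneralStructureWiringBloch.lean`) has none. CAVEAT C1: `SheafLift` is for FINITE LOCALLY FREE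
sheaves only (BF 5.1 as rendered; gap G44). Numbers: 2 new `@[conjecture]` defs, 9 theorems, 0 sorries, 0 new facts.

## References (bib keys)

Bloch1972Semiregularity (Introduction p. 51; Thm. 7.1, 7.4), BuchweitzFlenner2003 (§5 Thm. 5.1), Deligne1982HodgeCycles (Prop. 6.1, §6 pp. 59–61),
CharlesSchnell2014Notes (Prop. 11.3.11 (proof), Thm. 11.5.11), Mumford1969NoteShimura (§3), MumfordAV1970 (§22), VoisinHodgeII2003 (§3.1.2).
-/

noncomputable section

open CategoryTheory MonoidalCategory
open Literature.AlgebraicGeometry Literature.AlgebraicGeometry.Motives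
open Literature.AlgebraicGeometry.HodgeTheory
open Literature.AlgebraicGeometry.Milne1999 (IsOfCMType)
open Literature.AlgebraicGeometry.Deligne1982 (deligne1982_cmDenseMumfordTateFamilies)

namespace Summit.Ventures.HSemireg.GeneralStructure

open Summit.HodgeConjecture.HodgeConjecture
open Summit.HodgeConjecture.HodgeConjecture.Ring2.Deform (cmLocus CMDenseMumfordTateFamilies cmDenseMumfordTateFamilies_of_deligne1982)
open Summit.HodgeConjecture.HodgeConjecture.Ring2.Hypotheses (hc_av_iff_hc_cm_and_cmToAbelian)
open Summit.HodgeConjecture.HodgeConjecture.Ring2Transport (HodgeWeilType hodgeAbelianVarieties_iff_hodgeWeilType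
  mem_algebraicClasses_of_cmChart)
open Summit.HodgeConjecture.HodgeConjecture.Theorems.HodgeAbelianVarieties.CMPivot (isCM_iff_exists_cmSubalgebra)
open Summit.HodgeConjecture.HodgeConjecture.Cruxes.HodgeAbelianVarieties.SubtorusGalleryBlochSeeds.Stubs
  (unit_base isSmoothProjectiveFamily_toUnit fibreIncl_toUnit hodgeAlong_toUnit isIso_fiberι_toUnit)

/-! ### §0 Vocabulary (verbatim the companions' local notations) -/

/-- `IsCM[A]` — CM type in the eigenvalue typing (verbatim `Ring2HypothesesCMPivot`). Local notation only. -/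
local notation3 (prettyPrint := false) "IsCM[" A "]" =>
  ∃ (ψ : A ⟶ A) (μ : Fin (2 * AbelianVariety.dim A) → ℂ), Function.Injective μ ∧
    ∀ i, Module.End.HasEigenvalue (HodgeTheory.complexBetti.map ψ.hom.hom.hom 1).hom (μ i)

/-- `QProj[X]` — `X` quasi-projective over `ℂ` (inlined body of `HodgeTheory.IsQuasiProjectiveOver X`). Local notation only. -/
local notation3 (prettyPrint := false) "QProj[" X "]" =>
  ∃ (P : SchemeOver ℂ) (j : X ⟶ P), IsProjectiveOver P ∧ AlgebraicGeometry.IsOpenImmersion j.left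

/-- `FibreIncl[f, B, e, s]` — `e` presents `B` as the fibre of `f` over `s`. Local notation only. -/
local notation3 (prettyPrint := false) "FibreIncl[" f ", " B ", " e ", " s "]" =>
  ∃ i : AbelianVariety.X B ≅ fiberOver f s, e = CategoryStruct.comp i.hom (fiberι f s)

/-- `HodgeAlong[S, 𝒳, f, G, p]` — `G` is rational `(p,p)` on every fibre presented as an abelian variety. Local notation only. -/
local notation3 (prettyPrint := false) "HodgeAlong[" S ", " 𝒳 ", " f ", " G ", " p "]" =>
  ∀ (B : AbelianVariety ℂ) (eB : AbelianVariety.X B ⟶ 𝒳) (u : ComplexPoints S),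
    FibreIncl[f, B, eB, u] →
      HodgeTheory.IsRationalClass (HodgeTheory.complexBetti.map eB (2 * p) G) ∧
      HodgeTheory.IsOfHodgeType B.dim B.X (2 * p) p p (HodgeTheory.complexBetti.map eB (2 * p) G)

/-- `SheafLift[C, f, m, p, G, s]` — a Buchweitz–Flenner semiregular presentation of `G` at the fibre `s` (verbatim
`GeneralStructureWiringAnchor.lean`; FINITE LOCALLY FREE sheaves — CAVEAT C1). Local notation only. -/
local notation3 (prettyPrint := false) "SheafLift[" C ", " f ", " m ", " p ", " G ", " s "]" =>
  ∃ (U : Set (ComplexPoints _)) (hs : s ∈ U), IsOpen U ∧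
    ∃ (r : ℕ) (c : Fin r → ℂ) (E : Fin r → (fiberOver f s).left.Modules)
      (hE : ∀ i, IsFiniteLocallyFree (E i)) (Ideg : Fin r → Finset ℕ),
      (∀ i, p ∈ Ideg i) ∧ (∀ i, IsISemiregular (hE i) {q | q + 1 ∈ Ideg i}) ∧
      HodgeTheory.complexBetti.map (fiberι f s) (2 * p) G = ∑ i, c i • ChernCharacterBetti.ch C (fiberOver f s) (E i) p ∧
      ∀ (hU : IsCohomologicallyLocallyTrivialOn f U) (i : Fin r), ∀ q ∈ Ideg i,
        ∀ (t : U) (γ : Path.Homotopic.Quotient (⟨s, hs⟩ : U) t),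
          HodgeTheory.IsOfHodgeType m (fiberOver f t.1) (2 * q) q q
            (transportFun f (2 * q) hU γ (ChernCharacterBetti.ch C (fiberOver f s) (E i) q))

/-! ### §1 (F2) — ∃ over FAMILIES: Bloch's 1972 reduction in kernel form (`HC_CM` idle; grade KNOWN) -/

/-- **(F2) `SemiregularPresentedFamilies C` — ONE WITNESS FAMILY PER HODGE CLASS** (OURS, SPECULATIVE, OPEN — NOT a Literature fact; the
form a coverage table witnesses). For every complex abelian variety `A` and every rational `(p,p)` class `c` on `A` there EXIST a smooth
projective family `f : 𝒳 ⟶ S` of relative dimension `dim A` (`𝒳`, `S` quasi-projective, `S` smooth irreducible), a chart `e : A.X ≅ 𝒳_{s₁}`,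
a global class `W` with `e^*(W|_{𝒳_{s₁}}) = c`, and a point `s₀` at which `W` has a Buchweitz–Flenner semiregular presentation
(`SheafLift`). No CM condition, no algebraicity input: the presentation IS algebraic (Chern characters) and the semiregularity theorem IS
the transport. CLOSEST PRINT: Bloch 1972, Introduction p. 51 (verbatim: «it reduces Grothendieck's conjecture to the problem of finding
semi-regular representatives») — the representative GIVEN; Markman 2025 (fourfolds/sixfolds of Weil type: secant sheaves at NON-CM
points, preprint). HONEST LABEL: this is the ∃-form; its truth for ALL `(A, c)` is as open as `HC_AV` itself is plausible; no on-path
lemma (it asserts sheaves). NOT asserted. [cite: Bloch1972Semiregularity, Introduction p. 51 and Thm. (7.4)]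
[cite: BuchweitzFlenner2003, §5 Thm. 5.1] [status: open, speculative] -/
@[conjecture] def SemiregularPresentedFamilies (C : ChernCharacterBetti) : Prop :=
  ∀ (A : AbelianVariety ℂ) (p : ℕ) (c : HodgeTheory.complexBetti A.X (2 * p)),
    HodgeTheory.IsRationalClass c → HodgeTheory.IsOfHodgeType A.dim A.X (2 * p) p p c →
    ∃ (𝒳 S : SchemeOver ℂ) (f : 𝒳 ⟶ S) (s₁ : ComplexPoints S) (e : A.X ≅ fiberOver f s₁)
      (W : HodgeTheory.complexBetti 𝒳 (2 * p)) (s₀ : ComplexPoints S),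
      IsSmoothProjectiveFamily f A.dim ∧ QProj[𝒳] ∧ QProj[S] ∧ IrreducibleSpace S.left ∧ AlgebraicGeometry.Smooth S.hom ∧
      HodgeTheory.complexBetti.map e.hom (2 * p) (HodgeTheory.complexBetti.map (fiberι f s₁) (2 * p) W) = c ∧
      SheafLift[C, f, A.dim, p, W, s₀]

/-- **(F2) ∧ [Buchweitz–Flenner 5.1] ⟹ `HC_AV` — Bloch's reduction, kernel form** (NO `HC_CM`, NO Deligne, NO CM point: the red team's
«idle binders» made explicit — on THIS row they are simply absent). The presentation at `s₀` gives a non-empty open set of algebraic fibres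
(A-0, `exists_isOpen_forall_mem_algebraicClasses_of_sheafLift`); Baire + Hilbert schemes on the irreducible base
(`WeilTypeLadder.mem_algebraicClasses_of_isOpen_subset_algebraicityLocus`) give every fibre; pull back along the chart. Grade: KNOWN REDUCTION
(Bloch 1972 p. 51 + Charles–Schnell Prop. 11.3.11). [cite: Bloch1972Semiregularity, Introduction p. 51]
[cite: BuchweitzFlenner2003, §5 Thm. 5.1] [cite: CharlesSchnell2014Notes, Prop. 11.3.11 (proof)] -/
theorem hc_av_of_buchweitzFlenner_of_semiregularPresentedFamilies (C : ChernCharacterBetti)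
    (hBF : BuchweitzFlenner2003_variationalHodge_ISemiregular) (hF : SemiregularPresentedFamilies C) :
    Theses.PadicSemiregularLift.HodgeAbelianVarieties := by
  intro A
  refine ⟨nonempty_hodgeModel_holds AbelianVariety.isSmoothProjective_holds, fun p c hc hh ↦ ?_⟩
  obtain ⟨𝒳, S, f, s₁, e, W, s₀, hf, h𝒳, hS, hirr, hsm, hWc, hlift⟩ := hF A p c hc hh
  have hqS : IsQuasiProjectiveOver S := hS
  have hq𝒳 : IsQuasiProjectiveOver 𝒳 := h𝒳
  obtain ⟨U', hU'o, hs₀U', hU'alg⟩ :=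
    exists_isOpen_forall_mem_algebraicClasses_of_sheafLift C hBF f hf hqS hsm W s₀ hlift
  haveI := hirr
  have hall := WeilTypeLadder.mem_algebraicClasses_of_isOpen_subset_algebraicityLocus f hq𝒳 hqS hsm hf W hU'o
    ⟨s₀, hs₀U'⟩ hU'alg
  rw [← hWc]
  exact (mem_algebraicClasses_map_iff_of_iso e).2 (hall s₁)

/-- (F2) ∧ BF 5.1 ⟹ `HodgeWeilType` (ring 2's exactness `HC_AV ↔ HodgeWeilType`). [cite: Deligne1982HodgeCycles, §4 Lemma 4.5 and Remark 4.10] -/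
theorem hodgeWeilType_of_buchweitzFlenner_of_semiregularPresentedFamilies (C : ChernCharacterBetti)
    (hBF : BuchweitzFlenner2003_variationalHodge_ISemiregular) (hF : SemiregularPresentedFamilies C) : HodgeWeilType :=
  hodgeAbelianVarieties_iff_hodgeWeilType.1 (hc_av_of_buchweitzFlenner_of_semiregularPresentedFamilies C hBF hF)

/-- **HONEST COLUMN of (F2): `HC_CM` is DOMINATED** — (F2) ∧ BF 5.1 already give `HC_CM` (a case of `HC_AV`, `Ring2.Deform.HC_CM_of_HC_AV`).
[cite: Bloch1972Semiregularity, Introduction p. 51] -/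
theorem hc_cm_of_buchweitzFlenner_of_semiregularPresentedFamilies (C : ChernCharacterBetti)
    (hBF : BuchweitzFlenner2003_variationalHodge_ISemiregular) (hF : SemiregularPresentedFamilies C) :
    Theses.RankFourFaces.CMAbelianHodge :=
  Ring2.Deform.HC_CM_of_HC_AV (hc_av_of_buchweitzFlenner_of_semiregularPresentedFamilies C hBF hF)

/-! ### §2 (F1) — ∀ over CM-DENSE families, ∃ over their CM fibres: the weakest `HC_CM`-load-bearing form -/

/-- **(F1) `ExistsSemiregularSheafCMAnchorDense C` — ONE SEMIREGULAR CM FIBRE PER CM-DENSE FAMILY** (OURS, SPECULATIVE, OPEN — NOT a Literature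
fact). In the typing of Deligne's dense Mumford–Tate families (ring 2's `Ring2.Deform.CMDenseMumfordTateFamilies`: `f : 𝒳 ⟶ S` smooth projective
of relative dimension `n`, `𝒳`, `S` quasi-projective, `S` smooth irreducible, abelian charts at every fibre, a global class `W` fibrewise rational
`(p,p)`, and the CM locus `cmLocus f n` — fibres presented by CM abelian varieties, Milne's typing `IsOfCMType` — DENSE in `S(ℂ)`): IF `W` is
algebraic at every CM fibre (what `HC_CM` delivers) THEN some CM fibre `s₁` carries a Buchweitz–Flenner semiregular presentation
(`SheafLift`). Density excludes the generic-curve base change of RED-GS GS-8 (a); it does NOT exclude the point base (a CM point is CM-dense),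
so (F1) still entails the deformation-free shadow (★) (`existsAnchorDense_pointBase`), and it still quantifies over every CM-dense (special)
sub-family. HONEST LABEL: plausibly false as a `∀` over all such families (ring 2, ref1 F5); preferred form per-family witnesses = (F2);
NOT a case of HC; no on-path lemma. NOT asserted. [cite: Deligne1982HodgeCycles, Prop. 6.1 and §6 pp. 59–61]
[cite: BuchweitzFlenner2003, §5 Thm. 5.1] [cite: Bloch1972Semiregularity, Thm. (7.4)] [status: open, speculative] -/
@[conjecture] def ExistsSemiregularSheafCMAnchorDense (C : ChernCharacterBetti) : Prop :=
  ∀ (𝒳 S : SchemeOver ℂ) (f : 𝒳 ⟶ S) (n p : ℕ) (W : HodgeTheory.complexBetti 𝒳 (2 * p)),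
    IsSmoothProjectiveFamily f n → QProj[𝒳] → QProj[S] → IrreducibleSpace S.left → AlgebraicGeometry.Smooth S.hom →
    (∀ s : ComplexPoints S, ∃ A' : AbelianVariety ℂ, A'.dim = n ∧ Nonempty (A'.X ≅ fiberOver f s)) →
    (∀ s : ComplexPoints S, HodgeTheory.IsRationalClass (HodgeTheory.complexBetti.map (fiberι f s) (2 * p) W) ∧
      HodgeTheory.IsOfHodgeType n (fiberOver f s) (2 * p) p p (HodgeTheory.complexBetti.map (fiberι f s) (2 * p) W)) →
    Dense (cmLocus f n) →
    (∀ s ∈ cmLocus f n, HodgeTheory.complexBetti.map (fiberι f s) (2 * p) W ∈ HodgeTheory.algebraicClasses (fiberOver f s) p) →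
    ∃ s₁ ∈ cmLocus f n, SheafLift[C, f, n, p, W, s₁]

/-- **`HC_CM ∧ [Deligne 1982 Prop. 6.1, dense form] ∧ (F1) ⟹ (F2)`** — where `HC_CM` is consumed (kernel-checked): Deligne's dense
Mumford–Tate family of `(A, c)` (`CMDenseMumfordTateFamilies`) is CM-dense; `HC_CM` makes `W` algebraic at every CM fibre (ring 2's
`Ring2Transport.mem_algebraicClasses_of_cmChart`); (F1) picks the presented CM fibre; that family is the (F2) witness.
[cite: Deligne1982HodgeCycles, Prop. 6.1] [cite: CharlesSchnell2014Notes, Thm. 11.5.11] [cite: Milne1999, §2 p. 54] -/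
theorem semiregularPresentedFamilies_of_hc_cm_of_cmDense_of_existsAnchorDense (C : ChernCharacterBetti)
    (hCM : Theses.RankFourFaces.CMAbelianHodge) (hMT : CMDenseMumfordTateFamilies)
    (hL : ExistsSemiregularSheafCMAnchorDense C) : SemiregularPresentedFamilies C := by
  intro A p c hc hh
  obtain ⟨𝒳, S, f, s₁, e, W, hf, hq𝒳, hqS, hirr, hsm, hab, hW, hWc, hD⟩ :=
    hMT A AbelianVariety.isSmoothProjective_holds p c hc hh
  have halgCM : ∀ s ∈ cmLocus f A.dim,
      HodgeTheory.complexBetti.map (fiberι f s) (2 * p) W ∈ HodgeTheory.algebraicClasses (fiberOver f s) p := by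
    rintro s ⟨A₀, ⟨e₀⟩, hdim₀, hcm₀⟩
    exact mem_algebraicClasses_of_cmChart hCM A₀ e₀ hdim₀ hcm₀ (hW s).1 (hW s).2
  obtain ⟨s₀, -, hlift⟩ := hL 𝒳 S f A.dim p W hf hq𝒳 hqS hirr hsm hab hW hD halgCM
  exact ⟨𝒳, S, f, s₁, e, W, s₀, hf, hq𝒳, hqS, hirr, hsm, hWc, hlift⟩

/-- **(F1) row: `HC_CM ∧ CMDenseMumfordTateFamilies ∧ [BF 5.1] ∧ (F1) ⟹ HC_AV`** (`HC_CM` load-bearing, consumed once, not dominated: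
(F1) speaks only of classes already algebraic at CM fibres). [cite: Deligne1982HodgeCycles, Prop. 6.1] [cite: BuchweitzFlenner2003, §5 Thm. 5.1]
[cite: CharlesSchnell2014Notes, Prop. 11.3.11 (proof) and Thm. 11.5.11] -/
theorem hc_av_of_hc_cm_of_cmDense_of_buchweitzFlenner_of_existsAnchorDense (C : ChernCharacterBetti)
    (hCM : Theses.RankFourFaces.CMAbelianHodge) (hMT : CMDenseMumfordTateFamilies)
    (hBF : BuchweitzFlenner2003_variationalHodge_ISemiregular) (hL : ExistsSemiregularSheafCMAnchorDense C) :
    Theses.PadicSemiregularLift.HodgeAbelianVarieties :=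
  hc_av_of_buchweitzFlenner_of_semiregularPresentedFamilies C hBF
    (semiregularPresentedFamilies_of_hc_cm_of_cmDense_of_existsAnchorDense C hCM hMT hL)

/-- **(F1) row with Deligne's theorem supplied by PRINT**: `HC_CM ∧ [Deligne 1982 Prop. 6.1 / Charles–Schnell 11.5.11] ∧ [BF 5.1] ∧ (F1)
⟹ HC_AV ↔ HodgeWeilType` — THE END STATEMENT of seat G4 in its weakest `HC_CM`-load-bearing form. [cite: Deligne1982HodgeCycles, Prop. 6.1]
[cite: CharlesSchnell2014Notes, Thm. 11.5.11] [cite: BuchweitzFlenner2003, §5 Thm. 5.1] -/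
theorem hc_av_of_hc_cm_of_deligne1982_of_buchweitzFlenner_of_existsAnchorDense (C : ChernCharacterBetti)
    (hCM : Theses.RankFourFaces.CMAbelianHodge) (hD : deligne1982_cmDenseMumfordTateFamilies)
    (hBF : BuchweitzFlenner2003_variationalHodge_ISemiregular) (hL : ExistsSemiregularSheafCMAnchorDense C) :
    Theses.PadicSemiregularLift.HodgeAbelianVarieties ∧ HodgeWeilType :=
  have h := hc_av_of_hc_cm_of_cmDense_of_buchweitzFlenner_of_existsAnchorDense C hCM
    (cmDenseMumfordTateFamilies_of_deligne1982 hD) hBF hL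
  ⟨h, hodgeAbelianVarieties_iff_hodgeWeilType.1 h⟩

/-- **The landed ∃-form implies (F1)** (so (F1) is the WEAKEST of the `HC_CM`-load-bearing forms: ∀-form ⟹ ∃-form ⟹ (F1)): read the
dense family in the CM-pivot typing — a CM fibre exists by density (`IsOfCMType ↔ IsCM`, `CMPivot.isCM_iff_exists_cmSubalgebra`), the
fibrewise Hodge clause gives `HodgeAlong` through the abelian charts (`isRationalClass_map_iff_of_iso`, `isOfHodgeType_map_iff_of_iso`,
`schemeDim_eq_holds`), algebraicity moves along the presentations (`mem_algebraicClasses_map_iff_of_iso`) — and the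
presented fibre it returns lies in the CM locus. [cite: MumfordAV1970, §22] [cite: Deligne1982HodgeCycles, §6 p. 61] -/
theorem existsAnchorDense_of_existsAnchor (C : ChernCharacterBetti) (hL : ExistsSemiregularSheafCMAnchor C) :
    ExistsSemiregularSheafCMAnchorDense C := by
  intro 𝒳 S f n p W hf hq𝒳 hqS hirr hsm hab hW hD halg
  -- a CM fibre, by density
  haveI := hsm
  haveI := hirr
  haveI : Nonempty (ComplexPoints S) := ComplexPoints_nonempty_of_smooth S
  obtain ⟨s₀, A₀, ⟨e₀⟩, hdim₀, hcm₀⟩ := hD.nonempty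
  -- the CM-pivot reading of the antecedents
  have hG : HodgeAlong[S, 𝒳, f, W, p] := by
    rintro B eB u ⟨iB, hiB⟩
    have hBdim : B.dim = n := schemeDim_eq_holds ((hf.isSmoothProjective u).of_iso iB.symm)
    have he : HodgeTheory.complexBetti.map eB (2 * p) W =
        complexBetti.map iB.hom (2 * p) (complexBetti.map (fiberι f u) (2 * p) W) := by
      rw [hiB, complexBetti.map_comp]
      rfl
    rw [he, hBdim]
    exact ⟨(isRationalClass_map_iff_of_iso iB).2 (hW u).1, (isOfHodgeType_map_iff_of_iso iB).2 (hW u).2⟩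
  have halg' : ∀ (s : ComplexPoints S) (A' : AbelianVariety ℂ) (e' : A'.X ⟶ 𝒳), FibreIncl[f, A', e', s] → IsCM[A'] →
      HodgeTheory.complexBetti.map e' (2 * p) W ∈ HodgeTheory.algebraicClasses A'.X p := by
    rintro s A' e' ⟨i, hi⟩ hcm'
    have hs : s ∈ cmLocus f n :=
      ⟨A', ⟨i⟩, schemeDim_eq_holds ((hf.isSmoothProjective s).of_iso i.symm), (isCM_iff_exists_cmSubalgebra A').1 hcm'⟩
    have he : HodgeTheory.complexBetti.map e' (2 * p) W =
        complexBetti.map i.hom (2 * p) (complexBetti.map (fiberι f s) (2 * p) W) := by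
      rw [hi, complexBetti.map_comp]
      rfl
    rw [he]
    exact (mem_algebraicClasses_map_iff_of_iso i).2 (halg s hs)
  obtain ⟨s₁, A₁, e₁, ⟨i₁, -⟩, hcm₁, hlift⟩ := hL S 𝒳 f n p W hq𝒳 hqS hsm hirr hf hG
    ⟨s₀, A₀, e₀.hom ≫ fiberι f s₀, ⟨e₀, rfl⟩, (isCM_iff_exists_cmSubalgebra A₀).2 hcm₀⟩ halg'
  exact ⟨s₁, ⟨A₁, ⟨i₁⟩, schemeDim_eq_holds ((hf.isSmoothProjective s₁).of_iso i₁.symm), (isCM_iff_exists_cmSubalgebra A₁).1 hcm₁⟩, hlift⟩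

/-! ### §3 The deformation-free shadow (★) in kernel form (RED-GS GS-8 (b) / GS-9) -/

/-- **(★) — the landed ∃-form forces a semiregular presentation of EVERY rational algebraic `(p,p)` class on EVERY CM abelian variety,
with NO horizontality content**: apply it to the constant family `A₀ ⟶ Spec ℂ` (an admissible base: quasi-projective, smooth, irreducible —
`Stubs.unit_base`; a smooth projective family — `Stubs.isSmoothProjectiveFamily_toUnit`; `HodgeAlong` — `Stubs.hodgeAlong_toUnit`; every fibre
presented by `A₀` itself), whose base has ONE complex point: the presentation it returns sits on the fibre over that point (≅ `A₀`) and its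
horizontality clause is over constant paths. WHERE (★) IS FREE (so table rows there are no evidence for it): divisor-generated CM points
such as `E^{2n}` — ample line bundles `L` are `{p}`-semiregular for `p ≤ m − 1` (hard Lefschetz on `H^{0,2}`) and `{1,m}`-semiregular at `p = m`,
and `p`-th powers of ample classes span the degree-`2p` part of the divisor ring (RED-GS GS-9). WHERE IT HAS CONTENT: exceptional
algebraic classes, `2 ≤ p ≤ m − 2`. [cite: Bloch1972Semiregularity, Introduction p. 51] [cite: BuchweitzFlenner2003, §5 (I-semiregular)]
[cite: MumfordAV1970, §22] -/
theorem existsAnchor_pointBase (C : ChernCharacterBetti) (hL : ExistsSemiregularSheafCMAnchor C)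
    (A₀ : AbelianVariety ℂ) (hcm : IsCM[A₀]) {p : ℕ} {c : HodgeTheory.complexBetti A₀.X (2 * p)}
    (hc : HodgeTheory.IsRationalClass c) (hh : HodgeTheory.IsOfHodgeType A₀.dim A₀.X (2 * p) p p c)
    (halg : c ∈ HodgeTheory.algebraicClasses A₀.X p) :
    ∃ u : ComplexPoints (𝟙_ (SchemeOver ℂ)), SheafLift[C, CartesianMonoidalCategory.toUnit A₀.X, A₀.dim, p, c, u] := by
  obtain ⟨hS, hsm, hirr⟩ := unit_base
  have h𝒳 : IsQuasiProjectiveOver A₀.X :=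
    IsQuasiProjectiveOver.of_isProjectiveOver (AbelianVariety.isSmoothProjective_holds (A := A₀)).isProjectiveOver
  have halg' : ∀ (s : ComplexPoints (𝟙_ (SchemeOver ℂ))) (A' : AbelianVariety ℂ) (e' : A'.X ⟶ A₀.X),
      FibreIncl[CartesianMonoidalCategory.toUnit A₀.X, A', e', s] → IsCM[A'] →
        HodgeTheory.complexBetti.map e' (2 * p) c ∈ HodgeTheory.algebraicClasses A'.X p := by
    rintro s A' e' ⟨i, hi⟩ -
    haveI := isIso_fiberι_toUnit A₀ s
    have he : HodgeTheory.complexBetti.map e' (2 * p) c =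
        complexBetti.map (i ≪≫ asIso (fiberι (CartesianMonoidalCategory.toUnit A₀.X) s)).hom (2 * p) c := by
      rw [hi]
      rfl
    rw [he]
    exact (mem_algebraicClasses_map_iff_of_iso _).2 halg
  let u : ComplexPoints (𝟙_ (SchemeOver ℂ)) := Classical.arbitrary _
  obtain ⟨s₁, -, -, -, -, hlift⟩ := hL (𝟙_ (SchemeOver ℂ)) A₀.X (CartesianMonoidalCategory.toUnit A₀.X) A₀.dim p c
    h𝒳 hS hsm hirr (isSmoothProjectiveFamily_toUnit A₀) (hodgeAlong_toUnit hc hh)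
    ⟨u, A₀, 𝟙 A₀.X, fibreIncl_toUnit A₀ u, hcm⟩ halg'
  exact ⟨s₁, hlift⟩

/-- **(★) for (F1) as well**: the CM-dense form does not escape the point base (a CM point is CM-dense) — same specialisation through
`existsAnchorDense_of_existsAnchor`'s typing, stated for the constant family of a CM `A₀` in Milne's typing.
[cite: Bloch1972Semiregularity, Introduction p. 51] [cite: Milne1999, §2 p. 54] -/
theorem existsAnchorDense_pointBase (C : ChernCharacterBetti) (hL : ExistsSemiregularSheafCMAnchorDense C)
    (A₀ : AbelianVariety ℂ) (hcm : IsOfCMType A₀) {p : ℕ} {c : HodgeTheory.complexBetti A₀.X (2 * p)}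
    (hc : HodgeTheory.IsRationalClass c) (hh : HodgeTheory.IsOfHodgeType A₀.dim A₀.X (2 * p) p p c)
    (halg : c ∈ HodgeTheory.algebraicClasses A₀.X p) :
    ∃ u : ComplexPoints (𝟙_ (SchemeOver ℂ)), SheafLift[C, CartesianMonoidalCategory.toUnit A₀.X, A₀.dim, p, c, u] := by
  obtain ⟨hS, hsm, hirr⟩ := unit_base
  have hX := AbelianVariety.isSmoothProjective_holds (A := A₀)
  have h𝒳 : IsQuasiProjectiveOver A₀.X := IsQuasiProjectiveOver.of_isProjectiveOver hX.isProjectiveOver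
  set f := CartesianMonoidalCategory.toUnit A₀.X with hfdef
  have hf : IsSmoothProjectiveFamily f A₀.dim := isSmoothProjectiveFamily_toUnit A₀
  have hfib : ∀ s : ComplexPoints (𝟙_ (SchemeOver ℂ)), IsIso (fiberι f s) := isIso_fiberι_toUnit A₀
  have hab : ∀ s : ComplexPoints (𝟙_ (SchemeOver ℂ)), ∃ A' : AbelianVariety ℂ, A'.dim = A₀.dim ∧ Nonempty (A'.X ≅ fiberOver f s) :=
    fun s ↦ by haveI := hfib s; exact ⟨A₀, rfl, ⟨(asIso (fiberι f s)).symm⟩⟩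
  have hW : ∀ s : ComplexPoints (𝟙_ (SchemeOver ℂ)),
      HodgeTheory.IsRationalClass (HodgeTheory.complexBetti.map (fiberι f s) (2 * p) c) ∧
        HodgeTheory.IsOfHodgeType A₀.dim (fiberOver f s) (2 * p) p p (HodgeTheory.complexBetti.map (fiberι f s) (2 * p) c) := by
    intro s
    haveI := hfib s
    exact ⟨(isRationalClass_map_iff_of_iso (asIso (fiberι f s))).2 hc, (isOfHodgeType_map_iff_of_iso (asIso (fiberι f s))).2 hh⟩
  have hcmLocus : ∀ s : ComplexPoints (𝟙_ (SchemeOver ℂ)), s ∈ cmLocus f A₀.dim :=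
    fun s ↦ by haveI := hfib s; exact ⟨A₀, ⟨(asIso (fiberι f s)).symm⟩, rfl, hcm⟩
  have hD : Dense (cmLocus f A₀.dim) := fun s ↦ subset_closure (hcmLocus s)
  have halg' : ∀ s ∈ cmLocus f A₀.dim,
      HodgeTheory.complexBetti.map (fiberι f s) (2 * p) c ∈ HodgeTheory.algebraicClasses (fiberOver f s) p := by
    intro s _
    haveI := hfib s
    exact (mem_algebraicClasses_map_iff_of_iso (asIso (fiberι f s))).2 halg
  obtain ⟨s₁, -, hlift⟩ := hL A₀.X (𝟙_ (SchemeOver ℂ)) f A₀.dim p c hf h𝒳 hS hirr hsm hab hW hD halg'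
  exact ⟨s₁, hlift⟩

/-! ### §4 Position -/

/-- **POSITION of the family-level forms** (conjunction of tree theorems; RED-GS GS-8's dichotomy in the kernel): (a) landed ∃-form ⟹ (F1);
(b) `HC_CM ∧` Deligne-dense `∧ (F1) ⟹ (F2)`; (c) `(F2) ∧` BF 5.1 `⟹ HC_AV` with `HC_CM` absent; (d) `HC_AV ↔ HC_CM ∧ CMToAbelian`,
(e) `HC_AV ↔ HodgeWeilType`. [cite: Bloch1972Semiregularity, Introduction p. 51] [cite: Deligne1982HodgeCycles, Prop. 6.1 and §4] -/
theorem families_position (C : ChernCharacterBetti) :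
    (ExistsSemiregularSheafCMAnchor C → ExistsSemiregularSheafCMAnchorDense C) ∧
    (Theses.RankFourFaces.CMAbelianHodge → CMDenseMumfordTateFamilies → ExistsSemiregularSheafCMAnchorDense C →
      SemiregularPresentedFamilies C) ∧
    (BuchweitzFlenner2003_variationalHodge_ISemiregular → SemiregularPresentedFamilies C →
      Theses.PadicSemiregularLift.HodgeAbelianVarieties) ∧
    (Theses.PadicSemiregularLift.HodgeAbelianVarieties ↔
      Theses.RankFourFaces.CMAbelianHodge ∧ Theses.RankFourFaces.CMToAbelian) ∧
    (Theses.PadicSemiregularLift.HodgeAbelianVarieties ↔ HodgeWeilType) :=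
  ⟨existsAnchorDense_of_existsAnchor C, semiregularPresentedFamilies_of_hc_cm_of_cmDense_of_existsAnchorDense C,
    hc_av_of_buchweitzFlenner_of_semiregularPresentedFamilies C, hc_av_iff_hc_cm_and_cmToAbelian,
    hodgeAbelianVarieties_iff_hodgeWeilType⟩

/-! ## Audit: nothing is decided here

Every theorem above whose conclusion is `HC_AV`, `HodgeWeilType`, `HC_CM` or (F2) has among its hypotheses one of the team's OPEN,
SPECULATIVE family-level statements ((F1) or (F2)) together with named printed facts (Deligne 1982 Prop. 6.1 / `CMDenseMumfordTateFamilies`;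
Buchweitz–Flenner Thm. 5.1) and — on the (F1) rows — `HC_CM` by name; §3 are specialisations of the hypotheses themselves; the position row
is a conjunction of tree theorems. Axiom closures: the three standard axioms only. -/

#print axioms Summit.Ventures.HSemireg.GeneralStructure.hc_av_of_buchweitzFlenner_of_semiregularPresentedFamilies
#print axioms Summit.Ventures.HSemireg.GeneralStructure.semiregularPresentedFamilies_of_hc_cm_of_cmDense_of_existsAnchorDense
#print axioms Summit.Ventures.HSemireg.GeneralStructure.existsAnchorDense_of_existsAnchor
#print axioms Summit.Ventures.HSemireg.GeneralStructure.existsAnchor_pointBase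
#print axioms Summit.Ventures.HSemireg.GeneralStructure.existsAnchorDense_pointBase

end Summit.Ventures.HSemireg.GeneralStructure

end
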